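import Summits.Ventures.QEC.Theorems.BB72DistanceCertificateTarget
import Summits.Ventures.QEC.Census.BB.Claims
import Literature.InformationTheory.QuantumCodes.CSSFiniteSizeBounds
import HarnessLib

/-!
# Certified finite-size logical-error bounds for the bivariate-bicycle codes `[[72,12,6]]` (KERNEL,
# unconditional) and `[[144,12,12]]` (given its parameter claim)

Venture QEC, `Summits/Ventures/QEC/Thresholds/` (LADDER-QEC rung Q5 meets the census: the first NOISE
statements about the cell's flagship codes; qec-lit-2 gen 3). HONEST FRAMING. What is certified here is an
UPPER BOUND on the logical failure probability of one error type (`Z`-errors: detected by `H^X`, trivial iff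
in `rs H^Z`) under (i) independent errors of rate `p ≤ 1/2` with ANY minimum-weight decoder, (ii) independent
erasures of rate `y`, (iii) `T` rounds of noisy syndrome measurement with `q = p` and ANY minimum-weight
space-time decoder — by the Dumer–Kovalev–Pryadko cluster expansion at check weight `6`
(`Literature/…/CSSFiniteSizeBounds.lean`: `BB.zFailureProb_le`, `BB.zErasureProb_le`,
`BB.zPhenomFailureProb_le`), fed with the CERTIFIED distance. Tiers: the `[[72,12,6]]` rows use the KERNEL
theorem `bb72_d : BB.bb72.d = 6` (`BB72DistanceCertificateTarget.lean`, no `native_decide` in its cone) and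
are UNCONDITIONAL; the `[[144,12,12]]` rows take the parameter claim `BB144_12_12_claim` as a HYPOTHESIS `h`
(it is discharged in `BB144DistanceCertificateTarget.lean` at tier CHECKED-native, which this kernel-tier file
deliberately does not import). The bounds are rigorous but NOT tight (union bounds; e.g. `[[144,12,12]]` at
`p = 10⁻³`: `P_fail ≤ 57.6·(100 p(1-p))⁶ ≈ 5.7·10⁻⁵` per error type); Monte Carlo pseudo-thresholds are the
VALIDATED column and are not comparable statements. `P_fail` here is the tree's failure sum
`Σ_{e : ¬ D.Corrects} bernoulliWeight p (supp e)` (code capacity), `ErasureDecoder.uncorrectableProb`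
(erasures), `CSSPhenom.phenomFailureProb` (noisy measurement).

## References

* [DumerKovalevPryadko2015] I. Dumer, A. A. Kovalev, L. P. Pryadko, PRL 115 (2015) 050502, Thm 2, Thm 3, p. 5.
* [BravyiEtAl2024] S. Bravyi et al., Nature 627 (2024) 778, Table 1 (`[[72,12,6]]`, `[[144,12,12]]`).
-/

noncomputable section

namespace Summit.Ventures.QEC.Thresholds

open Finset Matrix
open Literature.InformationTheory.QuantumCodes
open Summit.Ventures.QEC.BB Summit.Ventures.QEC.Census.BB72

/-- `(10 s)^{2j} = (100 p(1-p))^j` for `s = √(p(1-p))`, `0 ≤ p ≤ 1`. [folklore] -/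
private theorem ten_sqrt_pow_two_mul {p : ℝ} (hp0 : 0 ≤ p) (hp1 : p ≤ 1) (j : ℕ) :
    (10 * Real.sqrt (p * (1 - p))) ^ (2 * j) = (100 * (p * (1 - p))) ^ j := by
  rw [pow_mul, mul_pow, Real.sq_sqrt (mul_nonneg hp0 (by linarith))]
  norm_num

/-- `(14 s)^{2j} = (196 p(1-p))^j`. [folklore] -/
private theorem fourteen_sqrt_pow_two_mul {p : ℝ} (hp0 : 0 ≤ p) (hp1 : p ≤ 1) (j : ℕ) :
    (14 * Real.sqrt (p * (1 - p))) ^ (2 * j) = (196 * (p * (1 - p))) ^ j := by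
  rw [pow_mul, mul_pow, Real.sq_sqrt (mul_nonneg hp0 (by linarith))]
  norm_num

/-! ### `[[72, 12, 6]]` — unconditional (kernel distance certificate `bb72_d`) -/

open Classical in
/-- **`[[72,12,6]]`, code capacity**: for EVERY minimum-weight `Z`-decoder and every `0 ≤ p ≤ 1/2` with
`10√(p(1-p)) < 1`, `P_fail ≤ 72·(100 p(1-p))³ / (5 (1 - 10√(p(1-p))))`. UNCONDITIONAL, kernel.
[cite: DumerKovalevPryadko2015, Thm 2 (y = 0, w = 6) with eq. (upper-bound-Nm-CSS)] -/
theorem bb72_zFailureProb_le {D : Decoder (BB.Mono 6 6 → ZMod 2) (BB.Mono 6 6 ⊕ BB.Mono 6 6 → ZMod 2)}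
    (hD : D.IsMinWeight BB.bb72.css.zSyndrome (BB.bb72.css.kerX : Set (BB.Mono 6 6 ⊕ BB.Mono 6 6 → ZMod 2))
      hammingNorm)
    {p : ℝ} (hp0 : 0 ≤ p) (hp : p ≤ 1 / 2) (hr : 10 * Real.sqrt (p * (1 - p)) < 1) :
    ∑ e ∈ univ.filter (fun e : BB.Mono 6 6 ⊕ BB.Mono 6 6 → ZMod 2 =>
        ¬ D.Corrects BB.bb72.css.zSyndrome (BB.bb72.css.rowSpZ : Set (BB.Mono 6 6 ⊕ BB.Mono 6 6 → ZMod 2)) e),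
        bernoulliWeight p (supp e) ≤
      72 * (100 * (p * (1 - p))) ^ 3 / (5 * (1 - 10 * Real.sqrt (p * (1 - p)))) := by
  have h := BB.zFailureProb_le BB.bb72 BB.isBBPoly_bb72.1 BB.isBBPoly_bb72.2 hD (by rw [bb72_d]; norm_num)
    hp0 hp hr
  have hpow : (10 * Real.sqrt (p * (1 - p))) ^ 6 = (100 * (p * (1 - p))) ^ 3 :=
    ten_sqrt_pow_two_mul hp0 (by linarith) 3
  rw [bb72_d, hpow] at h
  convert h using 2
  norm_num

open Classical in
/-- **`[[72,12,6]]`, code capacity, polynomial form**: if moreover `100 p(1-p) ≤ 1/4` (so the geometric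
tail factor is `≤ 2`), `P_fail ≤ 28.8 · (100 p(1-p))³`. UNCONDITIONAL, kernel.
[cite: DumerKovalevPryadko2015, Thm 2 (y = 0, w = 6)] -/
theorem bb72_zFailureProb_le_poly {D : Decoder (BB.Mono 6 6 → ZMod 2) (BB.Mono 6 6 ⊕ BB.Mono 6 6 → ZMod 2)}
    (hD : D.IsMinWeight BB.bb72.css.zSyndrome (BB.bb72.css.kerX : Set (BB.Mono 6 6 ⊕ BB.Mono 6 6 → ZMod 2))
      hammingNorm)
    {p : ℝ} (hp0 : 0 ≤ p) (hp : p ≤ 1 / 2) (hsmall : 100 * (p * (1 - p)) ≤ 1 / 4) :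
    ∑ e ∈ univ.filter (fun e : BB.Mono 6 6 ⊕ BB.Mono 6 6 → ZMod 2 =>
        ¬ D.Corrects BB.bb72.css.zSyndrome (BB.bb72.css.rowSpZ : Set (BB.Mono 6 6 ⊕ BB.Mono 6 6 → ZMod 2)) e),
        bernoulliWeight p (supp e) ≤
      28.8 * (100 * (p * (1 - p))) ^ 3 := by
  set u : ℝ := 100 * (p * (1 - p)) with hu
  have hu0 : 0 ≤ u := by rw [hu]; exact mul_nonneg (by norm_num) (mul_nonneg hp0 (by linarith))
  have hs : 10 * Real.sqrt (p * (1 - p)) ≤ 1 / 2 := by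
    have h1 : Real.sqrt (p * (1 - p)) ≤ Real.sqrt (1 / 400) := Real.sqrt_le_sqrt (by linarith)
    have h2 : Real.sqrt (1 / 400) = 1 / 20 := by
      rw [show (1 / 400 : ℝ) = (1 / 20) ^ 2 by norm_num, Real.sqrt_sq (by norm_num)]
    linarith
  have h := bb72_zFailureProb_le hD hp0 hp (by linarith)
  refine h.trans ?_
  rw [← hu]
  rw [div_le_iff₀ (by linarith)]
  have hu3 : 0 ≤ u ^ 3 := pow_nonneg hu0 3
  nlinarith

/-- **`[[72,12,6]]`, erasures**: the probability that an independent erasure pattern of rate `0 ≤ y < 1/5`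
is uncorrectable (for this error type) is `≤ 72 (5y)⁶ / (5 (1 - 5y))`. UNCONDITIONAL, kernel.
[cite: DumerKovalevPryadko2015, Thm 2 (erasure part, w = 6)] -/
theorem bb72_zErasureProb_le {y : ℝ} (hy0 : 0 ≤ y) (hy : 5 * y < 1) :
    ErasureDecoder.uncorrectableProb {x : BB.Mono 6 6 ⊕ BB.Mono 6 6 → ZMod 2 | BB.bb72.HX *ᵥ x = 0}
        (BB.bb72.css.rowSpZ : Set (BB.Mono 6 6 ⊕ BB.Mono 6 6 → ZMod 2)) y ≤
      72 * (5 * y) ^ 6 / (5 * (1 - 5 * y)) := by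
  have h := BB.zErasureProb_le BB.bb72 BB.isBBPoly_bb72.1 BB.isBBPoly_bb72.2 (by rw [bb72_d]; norm_num) hy0 hy
  rw [bb72_d] at h
  convert h using 2
  norm_num

/-- **`[[72,12,6]]`, noisy measurement** (`q = p`, `T` rounds, EVERY minimum-weight space-time decoder):
`P_fail ≤ 108 T · (196 p(1-p))³ / (7 (1 - 14√(p(1-p))))`. UNCONDITIONAL, kernel.
[cite: DumerKovalevPryadko2015, Thm 3 with p. 5 (w → w + 2)] -/
theorem bb72_zPhenomFailureProb_le (T : ℕ)
    {D : CSSPhenom.STDecoder (BB.Mono 6 6) (BB.Mono 6 6 ⊕ BB.Mono 6 6) T}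
    (hD : D.IsMinWeight (CSSPhenom.stSyn BB.bb72.HX T) (CSSPhenom.stCycles BB.bb72.HX T) hammingNorm)
    {p : ℝ} (hp0 : 0 ≤ p) (hp : p ≤ 1 / 2) (hr : 14 * Real.sqrt (p * (1 - p)) < 1) :
    CSSPhenom.phenomFailureProb BB.bb72.HX T (BB.bb72.css.rowSpZ : Set (BB.Mono 6 6 ⊕ BB.Mono 6 6 → ZMod 2))
        D p p ≤
      108 * T * (196 * (p * (1 - p))) ^ 3 / (7 * (1 - 14 * Real.sqrt (p * (1 - p)))) := by
  have h := BB.zPhenomFailureProb_le BB.bb72 BB.isBBPoly_bb72.1 BB.isBBPoly_bb72.2 T hD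
    (by rw [bb72_d]; norm_num) hp0 hp hr
  have hpow : (14 * Real.sqrt (p * (1 - p))) ^ 6 = (196 * (p * (1 - p))) ^ 3 :=
    fourteen_sqrt_pow_two_mul hp0 (by linarith) 3
  rw [bb72_d, hpow] at h
  convert h using 2
  push_cast
  ring

/-- Non-vacuity of the decoder class: the canonical minimum-weight `Z`-decoder of `[[72,12,6]]` qualifies
(so the bounds above are about an inhabited class of decoders). [cite: BravyiEtAl2024, §4 (Lemma 1: the code QC(A,B) and its logicals)] -/
theorem bb72_isMinWeight_minWeight :
    (Decoder.minWeight BB.bb72.css.zSyndrome hammingNorm).IsMinWeight BB.bb72.css.zSyndrome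
      (BB.bb72.css.kerX : Set (BB.Mono 6 6 ⊕ BB.Mono 6 6 → ZMod 2)) hammingNorm :=
  BB.bb72.css.isMinWeight_minWeight_zSyndrome

open Classical in
/-- **`[[72,12,6]]`, `X`-errors, code capacity** (every minimum-weight `X`-decoder; `H^Z` also has check
weight `6` and `d^X = d = 6`): `P_fail ≤ 72·(100 p(1-p))³ / (5 (1 - 10√(p(1-p))))`. UNCONDITIONAL, kernel.
[cite: DumerKovalevPryadko2015, Thm 2 (y = 0, w = 6)] -/
theorem bb72_xFailureProb_le {D : Decoder (BB.Mono 6 6 → ZMod 2) (BB.Mono 6 6 ⊕ BB.Mono 6 6 → ZMod 2)}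
    (hD : D.IsMinWeight BB.bb72.css.xSyndrome (BB.bb72.css.kerZ : Set (BB.Mono 6 6 ⊕ BB.Mono 6 6 → ZMod 2))
      hammingNorm)
    {p : ℝ} (hp0 : 0 ≤ p) (hp : p ≤ 1 / 2) (hr : 10 * Real.sqrt (p * (1 - p)) < 1) :
    ∑ e ∈ univ.filter (fun e : BB.Mono 6 6 ⊕ BB.Mono 6 6 → ZMod 2 =>
        ¬ D.Corrects BB.bb72.css.xSyndrome (BB.bb72.css.rowSpX : Set (BB.Mono 6 6 ⊕ BB.Mono 6 6 → ZMod 2)) e),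
        bernoulliWeight p (supp e) ≤
      72 * (100 * (p * (1 - p))) ^ 3 / (5 * (1 - 10 * Real.sqrt (p * (1 - p)))) := by
  have h := BB.xFailureProb_le BB.bb72 BB.isBBPoly_bb72.1 BB.isBBPoly_bb72.2 hD (by rw [bb72_d]; norm_num)
    hp0 hp hr
  have hpow : (10 * Real.sqrt (p * (1 - p))) ^ 6 = (100 * (p * (1 - p))) ^ 3 :=
    ten_sqrt_pow_two_mul hp0 (by linarith) 3
  rw [bb72_d, hpow] at h
  convert h using 2
  norm_num

open Classical in
/-- **`[[72,12,6]]`, `X`-errors, polynomial form**: `100 p(1-p) ≤ 1/4 ⇒ P_fail ≤ 28.8 (100 p(1-p))³`.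
UNCONDITIONAL, kernel. [cite: DumerKovalevPryadko2015, Thm 2 (y = 0, w = 6)] -/
theorem bb72_xFailureProb_le_poly {D : Decoder (BB.Mono 6 6 → ZMod 2) (BB.Mono 6 6 ⊕ BB.Mono 6 6 → ZMod 2)}
    (hD : D.IsMinWeight BB.bb72.css.xSyndrome (BB.bb72.css.kerZ : Set (BB.Mono 6 6 ⊕ BB.Mono 6 6 → ZMod 2))
      hammingNorm)
    {p : ℝ} (hp0 : 0 ≤ p) (hp : p ≤ 1 / 2) (hsmall : 100 * (p * (1 - p)) ≤ 1 / 4) :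
    ∑ e ∈ univ.filter (fun e : BB.Mono 6 6 ⊕ BB.Mono 6 6 → ZMod 2 =>
        ¬ D.Corrects BB.bb72.css.xSyndrome (BB.bb72.css.rowSpX : Set (BB.Mono 6 6 ⊕ BB.Mono 6 6 → ZMod 2)) e),
        bernoulliWeight p (supp e) ≤
      28.8 * (100 * (p * (1 - p))) ^ 3 := by
  set u : ℝ := 100 * (p * (1 - p)) with hu
  have hu0 : 0 ≤ u := by rw [hu]; exact mul_nonneg (by norm_num) (mul_nonneg hp0 (by linarith))
  have hs : 10 * Real.sqrt (p * (1 - p)) ≤ 1 / 2 := by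
    have h1 : Real.sqrt (p * (1 - p)) ≤ Real.sqrt (1 / 400) := Real.sqrt_le_sqrt (by linarith)
    have h2 : Real.sqrt (1 / 400) = 1 / 20 := by
      rw [show (1 / 400 : ℝ) = (1 / 20) ^ 2 by norm_num, Real.sqrt_sq (by norm_num)]
    linarith
  have h := bb72_xFailureProb_le hD hp0 hp (by linarith)
  refine h.trans ?_
  rw [← hu]
  rw [div_le_iff₀ (by linarith)]
  have hu3 : 0 ≤ u ^ 3 := pow_nonneg hu0 3
  nlinarith

/-- The canonical minimum-weight `X`-decoder of `[[72,12,6]]` qualifies. [cite: BravyiEtAl2024, §4 (Lemma 1)] -/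
theorem bb72_isMinWeight_minWeight_x :
    (Decoder.minWeight BB.bb72.css.xSyndrome hammingNorm).IsMinWeight BB.bb72.css.xSyndrome
      (BB.bb72.css.kerZ : Set (BB.Mono 6 6 ⊕ BB.Mono 6 6 → ZMod 2)) hammingNorm :=
  BB.bb72.css.isMinWeight_minWeight_xSyndrome

/-! ### `[[144, 12, 12]]` (the gross code) — given the parameter claim `h` -/

open Classical in
/-- **`[[144,12,12]]`, code capacity**, GIVEN the parameter claim (hypothesis `h`; discharged at tier
CHECKED-native elsewhere): for EVERY minimum-weight `Z`-decoder and `0 ≤ p ≤ 1/2` with `10√(p(1-p)) < 1`,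
`P_fail ≤ 144·(100 p(1-p))⁶ / (5 (1 - 10√(p(1-p))))`.
[cite: DumerKovalevPryadko2015, Thm 2 (y = 0, w = 6) with eq. (upper-bound-Nm-CSS)] -/
theorem bb144_zFailureProb_le (h : BB144_12_12_claim)
    {D : Decoder (BB.Mono 12 6 → ZMod 2) (BB.Mono 12 6 ⊕ BB.Mono 12 6 → ZMod 2)}
    (hD : D.IsMinWeight BB.bb144.css.zSyndrome
      (BB.bb144.css.kerX : Set (BB.Mono 12 6 ⊕ BB.Mono 12 6 → ZMod 2)) hammingNorm)
    {p : ℝ} (hp0 : 0 ≤ p) (hp : p ≤ 1 / 2) (hr : 10 * Real.sqrt (p * (1 - p)) < 1) :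
    ∑ e ∈ univ.filter (fun e : BB.Mono 12 6 ⊕ BB.Mono 12 6 → ZMod 2 =>
        ¬ D.Corrects BB.bb144.css.zSyndrome
          (BB.bb144.css.rowSpZ : Set (BB.Mono 12 6 ⊕ BB.Mono 12 6 → ZMod 2)) e),
        bernoulliWeight p (supp e) ≤
      144 * (100 * (p * (1 - p))) ^ 6 / (5 * (1 - 10 * Real.sqrt (p * (1 - p)))) := by
  have hd : BB.bb144.d = 12 := h.2.2
  have h' := BB.zFailureProb_le BB.bb144 BB.isBBPoly_bb144.1 BB.isBBPoly_bb144.2 hD (by rw [hd]; norm_num)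
    hp0 hp hr
  have hpow : (10 * Real.sqrt (p * (1 - p))) ^ 12 = (100 * (p * (1 - p))) ^ 6 :=
    ten_sqrt_pow_two_mul hp0 (by linarith) 6
  rw [hd, hpow] at h'
  convert h' using 2
  norm_num

open Classical in
/-- **`[[144,12,12]]`, polynomial form**, GIVEN the claim: if `100 p(1-p) ≤ 1/4` then
`P_fail ≤ 57.6 · (100 p(1-p))⁶` (e.g. `p = 10⁻³`: `≤ 5.7·10⁻⁵`).
[cite: DumerKovalevPryadko2015, Thm 2 (y = 0, w = 6)] -/
theorem bb144_zFailureProb_le_poly (h : BB144_12_12_claim)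
    {D : Decoder (BB.Mono 12 6 → ZMod 2) (BB.Mono 12 6 ⊕ BB.Mono 12 6 → ZMod 2)}
    (hD : D.IsMinWeight BB.bb144.css.zSyndrome
      (BB.bb144.css.kerX : Set (BB.Mono 12 6 ⊕ BB.Mono 12 6 → ZMod 2)) hammingNorm)
    {p : ℝ} (hp0 : 0 ≤ p) (hp : p ≤ 1 / 2) (hsmall : 100 * (p * (1 - p)) ≤ 1 / 4) :
    ∑ e ∈ univ.filter (fun e : BB.Mono 12 6 ⊕ BB.Mono 12 6 → ZMod 2 =>
        ¬ D.Corrects BB.bb144.css.zSyndrome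
          (BB.bb144.css.rowSpZ : Set (BB.Mono 12 6 ⊕ BB.Mono 12 6 → ZMod 2)) e),
        bernoulliWeight p (supp e) ≤
      57.6 * (100 * (p * (1 - p))) ^ 6 := by
  set u : ℝ := 100 * (p * (1 - p)) with hu
  have hu0 : 0 ≤ u := by rw [hu]; exact mul_nonneg (by norm_num) (mul_nonneg hp0 (by linarith))
  have hs : 10 * Real.sqrt (p * (1 - p)) ≤ 1 / 2 := by
    have h1 : Real.sqrt (p * (1 - p)) ≤ Real.sqrt (1 / 400) := Real.sqrt_le_sqrt (by linarith)
    have h2 : Real.sqrt (1 / 400) = 1 / 20 := by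
      rw [show (1 / 400 : ℝ) = (1 / 20) ^ 2 by norm_num, Real.sqrt_sq (by norm_num)]
    linarith
  have h' := bb144_zFailureProb_le h hD hp0 hp (by linarith)
  refine h'.trans ?_
  rw [← hu]
  rw [div_le_iff₀ (by linarith)]
  have hu6 : 0 ≤ u ^ 6 := pow_nonneg hu0 6
  nlinarith

/-- **`[[144,12,12]]`, erasures**, GIVEN the claim: an independent erasure pattern of rate `0 ≤ y < 1/5` is
uncorrectable with probability `≤ 144 (5y)¹² / (5 (1 - 5y))`.
[cite: DumerKovalevPryadko2015, Thm 2 (erasure part, w = 6)] -/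
theorem bb144_zErasureProb_le (h : BB144_12_12_claim) {y : ℝ} (hy0 : 0 ≤ y) (hy : 5 * y < 1) :
    ErasureDecoder.uncorrectableProb {x : BB.Mono 12 6 ⊕ BB.Mono 12 6 → ZMod 2 | BB.bb144.HX *ᵥ x = 0}
        (BB.bb144.css.rowSpZ : Set (BB.Mono 12 6 ⊕ BB.Mono 12 6 → ZMod 2)) y ≤
      144 * (5 * y) ^ 12 / (5 * (1 - 5 * y)) := by
  have hd : BB.bb144.d = 12 := h.2.2
  have h' := BB.zErasureProb_le BB.bb144 BB.isBBPoly_bb144.1 BB.isBBPoly_bb144.2 (by rw [hd]; norm_num)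
    hy0 hy
  rw [hd] at h'
  convert h' using 2
  norm_num

/-- **`[[144,12,12]]`, noisy measurement** (`q = p`, `T` rounds, EVERY minimum-weight space-time decoder),
GIVEN the claim: `P_fail ≤ 216 T · (196 p(1-p))⁶ / (7 (1 - 14√(p(1-p))))`.
[cite: DumerKovalevPryadko2015, Thm 3 with p. 5 (w → w + 2)] -/
theorem bb144_zPhenomFailureProb_le (h : BB144_12_12_claim) (T : ℕ)
    {D : CSSPhenom.STDecoder (BB.Mono 12 6) (BB.Mono 12 6 ⊕ BB.Mono 12 6) T}
    (hD : D.IsMinWeight (CSSPhenom.stSyn BB.bb144.HX T) (CSSPhenom.stCycles BB.bb144.HX T) hammingNorm)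
    {p : ℝ} (hp0 : 0 ≤ p) (hp : p ≤ 1 / 2) (hr : 14 * Real.sqrt (p * (1 - p)) < 1) :
    CSSPhenom.phenomFailureProb BB.bb144.HX T
        (BB.bb144.css.rowSpZ : Set (BB.Mono 12 6 ⊕ BB.Mono 12 6 → ZMod 2)) D p p ≤
      216 * T * (196 * (p * (1 - p))) ^ 6 / (7 * (1 - 14 * Real.sqrt (p * (1 - p)))) := by
  have hd : BB.bb144.d = 12 := h.2.2
  have h' := BB.zPhenomFailureProb_le BB.bb144 BB.isBBPoly_bb144.1 BB.isBBPoly_bb144.2 T hD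
    (by rw [hd]; norm_num) hp0 hp hr
  have hpow : (14 * Real.sqrt (p * (1 - p))) ^ 12 = (196 * (p * (1 - p))) ^ 6 :=
    fourteen_sqrt_pow_two_mul hp0 (by linarith) 6
  rw [hd, hpow] at h'
  convert h' using 2
  push_cast
  ring

open Classical in
/-- **`[[144,12,12]]`, `X`-errors, code capacity**, GIVEN the claim: every minimum-weight `X`-decoder has
`P_fail ≤ 144·(100 p(1-p))⁶ / (5 (1 - 10√(p(1-p))))`. [cite: DumerKovalevPryadko2015, Thm 2 (y = 0, w = 6)] -/
theorem bb144_xFailureProb_le (h : BB144_12_12_claim)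
    {D : Decoder (BB.Mono 12 6 → ZMod 2) (BB.Mono 12 6 ⊕ BB.Mono 12 6 → ZMod 2)}
    (hD : D.IsMinWeight BB.bb144.css.xSyndrome
      (BB.bb144.css.kerZ : Set (BB.Mono 12 6 ⊕ BB.Mono 12 6 → ZMod 2)) hammingNorm)
    {p : ℝ} (hp0 : 0 ≤ p) (hp : p ≤ 1 / 2) (hr : 10 * Real.sqrt (p * (1 - p)) < 1) :
    ∑ e ∈ univ.filter (fun e : BB.Mono 12 6 ⊕ BB.Mono 12 6 → ZMod 2 =>
        ¬ D.Corrects BB.bb144.css.xSyndrome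
          (BB.bb144.css.rowSpX : Set (BB.Mono 12 6 ⊕ BB.Mono 12 6 → ZMod 2)) e),
        bernoulliWeight p (supp e) ≤
      144 * (100 * (p * (1 - p))) ^ 6 / (5 * (1 - 10 * Real.sqrt (p * (1 - p)))) := by
  have hd : BB.bb144.d = 12 := h.2.2
  have h' := BB.xFailureProb_le BB.bb144 BB.isBBPoly_bb144.1 BB.isBBPoly_bb144.2 hD (by rw [hd]; norm_num)
    hp0 hp hr
  have hpow : (10 * Real.sqrt (p * (1 - p))) ^ 12 = (100 * (p * (1 - p))) ^ 6 :=
    ten_sqrt_pow_two_mul hp0 (by linarith) 6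
  rw [hd, hpow] at h'
  convert h' using 2
  norm_num

open Classical in
/-- **`[[144,12,12]]`, `X`-errors, polynomial form**, GIVEN the claim: `100 p(1-p) ≤ 1/4 ⇒
P_fail ≤ 57.6 (100 p(1-p))⁶`. [cite: DumerKovalevPryadko2015, Thm 2 (y = 0, w = 6)] -/
theorem bb144_xFailureProb_le_poly (h : BB144_12_12_claim)
    {D : Decoder (BB.Mono 12 6 → ZMod 2) (BB.Mono 12 6 ⊕ BB.Mono 12 6 → ZMod 2)}
    (hD : D.IsMinWeight BB.bb144.css.xSyndrome
      (BB.bb144.css.kerZ : Set (BB.Mono 12 6 ⊕ BB.Mono 12 6 → ZMod 2)) hammingNorm)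
    {p : ℝ} (hp0 : 0 ≤ p) (hp : p ≤ 1 / 2) (hsmall : 100 * (p * (1 - p)) ≤ 1 / 4) :
    ∑ e ∈ univ.filter (fun e : BB.Mono 12 6 ⊕ BB.Mono 12 6 → ZMod 2 =>
        ¬ D.Corrects BB.bb144.css.xSyndrome
          (BB.bb144.css.rowSpX : Set (BB.Mono 12 6 ⊕ BB.Mono 12 6 → ZMod 2)) e),
        bernoulliWeight p (supp e) ≤
      57.6 * (100 * (p * (1 - p))) ^ 6 := by
  set u : ℝ := 100 * (p * (1 - p)) with hu
  have hu0 : 0 ≤ u := by rw [hu]; exact mul_nonneg (by norm_num) (mul_nonneg hp0 (by linarith))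
  have hs : 10 * Real.sqrt (p * (1 - p)) ≤ 1 / 2 := by
    have h1 : Real.sqrt (p * (1 - p)) ≤ Real.sqrt (1 / 400) := Real.sqrt_le_sqrt (by linarith)
    have h2 : Real.sqrt (1 / 400) = 1 / 20 := by
      rw [show (1 / 400 : ℝ) = (1 / 20) ^ 2 by norm_num, Real.sqrt_sq (by norm_num)]
    linarith
  have h' := bb144_xFailureProb_le h hD hp0 hp (by linarith)
  refine h'.trans ?_
  rw [← hu]
  rw [div_le_iff₀ (by linarith)]
  have hu6 : 0 ≤ u ^ 6 := pow_nonneg hu0 6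
  nlinarith

/-! ### Any bivariate-bicycle code, given its census row `HasParams C n k d` -/

open Classical in
/-- **Generic census interface**: for every bivariate-bicycle code `QC(A, B)` (`IsBBPoly`) and every census
row `HasParams C n k d` with `d ≥ 1` (proved or taken as hypothesis — `BB90_8_10_claim`, `BB108_8_10_claim`,
`BB288_12_18_claim`, …), every minimum-weight `Z`-decoder has
`P_fail ≤ n · (10 √(p(1-p)))^d / (5 (1 - 10 √(p(1-p))))` under independent errors of rate `p ≤ 1/2`.
[cite: DumerKovalevPryadko2015, Thm 2 (y = 0, w = 6) with eq. (upper-bound-Nm-CSS)] -/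
theorem bb_zFailureProb_le_of_hasParams {ℓ m : ℕ} [NeZero ℓ] [NeZero m] (C : BB.Code ℓ m)
    (hA : BB.IsBBPoly C.A) (hB : BB.IsBBPoly C.B) {n k d : ℕ} (h : HasParams C n k d) (hd1 : 1 ≤ d)
    {D : Decoder (BB.Mono ℓ m → ZMod 2) (BB.Mono ℓ m ⊕ BB.Mono ℓ m → ZMod 2)}
    (hD : D.IsMinWeight C.css.zSyndrome (C.css.kerX : Set (BB.Mono ℓ m ⊕ BB.Mono ℓ m → ZMod 2)) hammingNorm)
    {p : ℝ} (hp0 : 0 ≤ p) (hp : p ≤ 1 / 2) (hr : 10 * Real.sqrt (p * (1 - p)) < 1) :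
    ∑ e ∈ univ.filter (fun e : BB.Mono ℓ m ⊕ BB.Mono ℓ m → ZMod 2 =>
        ¬ D.Corrects C.css.zSyndrome (C.css.rowSpZ : Set (BB.Mono ℓ m ⊕ BB.Mono ℓ m → ZMod 2)) e),
        bernoulliWeight p (supp e) ≤
      (n : ℝ) * (10 * Real.sqrt (p * (1 - p))) ^ d / (5 * (1 - 10 * Real.sqrt (p * (1 - p)))) := by
  obtain ⟨hn, -, hd⟩ := h
  have h' := BB.zFailureProb_le C hA hB hD (by rw [hd]; exact hd1) hp0 hp hr
  rw [hd] at h'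
  rw [← hn, BB.numQubits_eq]
  exact h'

open Classical in
/-- `X`-sector twin of `bb_zFailureProb_le_of_hasParams`. [cite: DumerKovalevPryadko2015, Thm 2 (y = 0, w = 6)] -/
theorem bb_xFailureProb_le_of_hasParams {ℓ m : ℕ} [NeZero ℓ] [NeZero m] (C : BB.Code ℓ m)
    (hA : BB.IsBBPoly C.A) (hB : BB.IsBBPoly C.B) {n k d : ℕ} (h : HasParams C n k d) (hd1 : 1 ≤ d)
    {D : Decoder (BB.Mono ℓ m → ZMod 2) (BB.Mono ℓ m ⊕ BB.Mono ℓ m → ZMod 2)}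
    (hD : D.IsMinWeight C.css.xSyndrome (C.css.kerZ : Set (BB.Mono ℓ m ⊕ BB.Mono ℓ m → ZMod 2)) hammingNorm)
    {p : ℝ} (hp0 : 0 ≤ p) (hp : p ≤ 1 / 2) (hr : 10 * Real.sqrt (p * (1 - p)) < 1) :
    ∑ e ∈ univ.filter (fun e : BB.Mono ℓ m ⊕ BB.Mono ℓ m → ZMod 2 =>
        ¬ D.Corrects C.css.xSyndrome (C.css.rowSpX : Set (BB.Mono ℓ m ⊕ BB.Mono ℓ m → ZMod 2)) e),
        bernoulliWeight p (supp e) ≤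
      (n : ℝ) * (10 * Real.sqrt (p * (1 - p))) ^ d / (5 * (1 - 10 * Real.sqrt (p * (1 - p)))) := by
  obtain ⟨hn, -, hd⟩ := h
  have h' := BB.xFailureProb_le C hA hB hD (by rw [hd]; exact hd1) hp0 hp hr
  rw [hd] at h'
  rw [← hn, BB.numQubits_eq]
  exact h'

/-- **Erasures, generic census interface**: `≤ n (5y)^d / (5(1-5y))` for every BB census row.
[cite: DumerKovalevPryadko2015, Thm 2 (erasure part, w = 6)] -/
theorem bb_zErasureProb_le_of_hasParams {ℓ m : ℕ} [NeZero ℓ] [NeZero m] (C : BB.Code ℓ m)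
    (hA : BB.IsBBPoly C.A) (hB : BB.IsBBPoly C.B) {n k d : ℕ} (h : HasParams C n k d) (hd1 : 1 ≤ d)
    {y : ℝ} (hy0 : 0 ≤ y) (hy : 5 * y < 1) :
    ErasureDecoder.uncorrectableProb {x : BB.Mono ℓ m ⊕ BB.Mono ℓ m → ZMod 2 | C.HX *ᵥ x = 0}
        (C.css.rowSpZ : Set (BB.Mono ℓ m ⊕ BB.Mono ℓ m → ZMod 2)) y ≤
      (n : ℝ) * (5 * y) ^ d / (5 * (1 - 5 * y)) := by
  obtain ⟨hn, -, hd⟩ := h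
  have h' := BB.zErasureProb_le C hA hB (by rw [hd]; exact hd1) hy0 hy
  rw [hd] at h'
  rw [← hn, BB.numQubits_eq]
  exact h'

/-- **Noisy measurement, generic census interface**: `≤ (3n/2) T · (14 s)^d / (7 (1 - 14 s))` — stated with
`3ℓmT = (3/2)·n·T` space-time locations. [cite: DumerKovalevPryadko2015, Thm 3 with p. 5 (w → w + 2)] -/
theorem bb_zPhenomFailureProb_le_of_hasParams {ℓ m : ℕ} [NeZero ℓ] [NeZero m] (C : BB.Code ℓ m)
    (hA : BB.IsBBPoly C.A) (hB : BB.IsBBPoly C.B) {n k d : ℕ} (h : HasParams C n k d) (hd1 : 1 ≤ d) (T : ℕ)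
    {D : CSSPhenom.STDecoder (BB.Mono ℓ m) (BB.Mono ℓ m ⊕ BB.Mono ℓ m) T}
    (hD : D.IsMinWeight (CSSPhenom.stSyn C.HX T) (CSSPhenom.stCycles C.HX T) hammingNorm)
    {p : ℝ} (hp0 : 0 ≤ p) (hp : p ≤ 1 / 2) (hr : 14 * Real.sqrt (p * (1 - p)) < 1) :
    CSSPhenom.phenomFailureProb C.HX T (C.css.rowSpZ : Set (BB.Mono ℓ m ⊕ BB.Mono ℓ m → ZMod 2)) D p p ≤
      (3 * ℓ * m * T : ℕ) * (14 * Real.sqrt (p * (1 - p))) ^ d / (7 * (1 - 14 * Real.sqrt (p * (1 - p)))) := by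
  obtain ⟨-, -, hd⟩ := h
  have h' := BB.zPhenomFailureProb_le C hA hB T hD (by rw [hd]; exact hd1) hp0 hp hr
  rw [hd] at h'
  exact h'

end Summit.Ventures.QEC.Thresholds
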